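import Mathlib
import Summits.AtomisticToContinuum.HydrodynamicLimit.Theorems.InformationPercolationEngineKickFairRelEquilibriumMesoConditionThePastDefs
import Summits.AtomisticToContinuum.HydrodynamicLimit.Theorems.InformationPercolationEngineKickFairRelEquilibriumMesoTransferAE
import Summits.AtomisticToContinuum.HydrodynamicLimit.Theorems.InformationPercolationEngineKickFairRelEquilibriumMesoTransferSlots
import Summits.AtomisticToContinuum.HydrodynamicLimit.Theorems.InformationPercolationEngineKickFairRelEquilibriumMesoPastMeasurable
import Summits.AtomisticToContinuum.HydrodynamicLimit.Theorems.KickFairRelEquilibriumMeso.Negative.WindowAlgebra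
import Literature.MathematicalPhysics.KineticTheory.LocalGibbsConstEquivalence
import Literature.MathematicalPhysics.KineticTheory.EvenStatTruncationBound
import HarnessLib

/-!
# `KickFairRelEquilibriumMeso`, line `condition-the-past` — stub Red-A `stub_reductionA`:
# the first half of the reduction, `B1 → CT-a → TF → MesoBody rs`

Prover file (`--supports stmt-AtomisticToContinuum-15177`) for the registered stub `stub_reductionA` of the
checked skeleton `Cruxes/KickFairRelEquilibriumMeso/Lines/condition_the_past.lean` (rev 2, lead c7) of the crux
`Summit.AtomisticToContinuum.HydrodynamicLimit.Theses.InformationPercolationEngine.KickFairRelEquilibriumMeso`.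

The body of the crux along a cell sequence (`MesoBody rs`, `Negative/WindowAlgebra`) asks `E_{LG} |S_h| ≤ δ`
eventually in `N`, uniformly over measurable weights `|h| ≤ 1` of the typed past, where
`S_h = fullSum = (ε/(N+1)) Σ_i Σ_{n<cnt_i} h_{i,n}(P_{i,n}) D_{i,n}`, `D = kickDev = g(X) − κ`
(`KickBoundRel … = ∫⁻ ofReal |fullSum …| ≤ ofReal δ` definitionally). Write `D = β + ξ` with `β = betaLG`
(the `LG`-conditional bias) and `ξ = D − β`. Pointwise (`LG`-a.e.),
`|S_h| ≤ (ε/(N+1)) ΣΣ |β| + |(ε/(N+1)) ΣΣ 1_{n < A(N+1)^{1/3}} h ξ| + 4C · (ε/(N+1)) Σ_i (cnt_i − A(N+1)^{1/3})₊`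
(`abs_mul_sum_sum_le`, `sum_range_one_sub_ite_le`): `|h| ≤ 1` and `|ξ| ≤ |D| + |β| ≤ 2C + 2C` simultaneously for
all `(i, n)` a.e. — `|κ| ≤ C` holds `G`-a.e. (`ae_forall_abs_kappa_le`) hence `LG`-a.e. (`LG ≪ G`,
`localGibbsLaw_absolutelyContinuous_localGibbsLaw`), so `|D| ≤ 2C` and `|β| ≤ 2C` `LG`-a.e.
(`ae_bdd_abs_condExp_of_ae_bdd_abs`); the tail `n ≥ A(N+1)^{1/3}` has at most `(cnt_i − A(N+1)^{1/3})₊` terms.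
The three pieces are the integrands of `SingleKickBias` (B1), `TruncatedFluctuation` (TF), `CountExcessLG` (CT-a);
integrate (`lintegral_mono_ae`, `lintegral_add_left'/right'` — a.e.-measurability of the B1 and CT-a integrands
through the good-set-guarded count `gcnt`, `localGibbsLaw_compl_good_eq_zero` — and `lintegral_const_mul'`):
`lintegral_abs_fullSum_le`. Bookkeeping: `σ₀ := min (min σ₁ σ₂) (min σ₃ (1/2))`, B1 at `δ/3`, CT-a at
`δ/(3(4C+1))` (giving `A`), TF at `(A, δ/3)`, `N₀ := max`.
-/

noncomputable section

open MeasureTheory Set Filter Topology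
open scoped ENNReal Classical

namespace Summit.AtomisticToContinuum.HydrodynamicLimit.Theorems.KickFairRelEquilibriumMesoLine

open Literature.Analysis.FluidPDE Literature.MathematicalPhysics.KineticTheory
open Summit.AtomisticToContinuum.HydrodynamicLimit.Theorems.KickFairRelEquilibriumMesoNegative
  (KickBoundRel MesoBody)

variable {σ : ℝ} {N : ℕ}

/-! ## Two elementary inequalities -/

/-- **The number of indices `n < K` beyond a real level `a` is at most `(K − a)₊`**:
`Σ_{n<K} (1 − 1_{n<a}) ≤ max (K − a) 0`. [folklore] -/
theorem sum_range_one_sub_ite_le (K : ℕ) (a : ℝ) :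
    ∑ n ∈ Finset.range K, (1 - (if (n : ℝ) < a then (1 : ℝ) else 0)) ≤ max ((K : ℝ) - a) 0 := by
  induction K with
  | zero => simp
  | succ K ih =>
    rw [Finset.sum_range_succ]
    push_cast
    by_cases hK : (K : ℝ) < a
    · rw [if_pos hK, sub_self, add_zero]
      exact ih.trans (max_le_max (by linarith) le_rfl)
    · rw [if_neg hK, sub_zero]
      have hK' : a ≤ (K : ℝ) := not_lt.1 hK
      rw [max_eq_left (sub_nonneg.2 hK')] at ih
      calc ∑ n ∈ Finset.range K, (1 - (if (n : ℝ) < a then (1 : ℝ) else 0)) + 1 ≤ (K : ℝ) + 1 - a := by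
            linarith
        _ ≤ max ((K : ℝ) + 1 - a) 0 := le_max_left _ _

/-- **The pointwise splitting of a weighted double sum** `c ΣΣ w D` with `|w| ≤ 1`, `D = β + (D − β)`,
`|D − β| ≤ B`, and a cut `I ≤ 1` of the inner index:
`|c ΣΣ w D| ≤ c ΣΣ |β| + |c ΣΣ I · w (D − β)| + B · c ΣΣ (1 − I)`. [folklore] -/
theorem abs_mul_sum_sum_le {ι : Type*} (s : Finset ι) (K : ι → ℕ) (w D β : ι → ℕ → ℝ) (I : ℕ → ℝ)
    {c B : ℝ} (hc : 0 ≤ c) (hw : ∀ i n, |w i n| ≤ 1) (hI : ∀ n, I n ≤ 1)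
    (hDβ : ∀ i ∈ s, ∀ n, |D i n - β i n| ≤ B) :
    |c * ∑ i ∈ s, ∑ n ∈ Finset.range (K i), w i n * D i n| ≤
      c * ∑ i ∈ s, ∑ n ∈ Finset.range (K i), |β i n| +
      |c * ∑ i ∈ s, ∑ n ∈ Finset.range (K i), I n * (w i n * (D i n - β i n))| +
      B * (c * ∑ i ∈ s, ∑ n ∈ Finset.range (K i), (1 - I n)) := by
  -- the decomposition `w D = w β + I (w (D − β)) + (1 − I) (w (D − β))`
  have hdec : c * ∑ i ∈ s, ∑ n ∈ Finset.range (K i), w i n * D i n =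
      c * ∑ i ∈ s, ∑ n ∈ Finset.range (K i), w i n * β i n +
      c * ∑ i ∈ s, ∑ n ∈ Finset.range (K i), I n * (w i n * (D i n - β i n)) +
      c * ∑ i ∈ s, ∑ n ∈ Finset.range (K i), (1 - I n) * (w i n * (D i n - β i n)) := by
    rw [← mul_add, ← mul_add, ← Finset.sum_add_distrib, ← Finset.sum_add_distrib]
    congr 1
    refine Finset.sum_congr rfl fun i _ => ?_
    rw [← Finset.sum_add_distrib, ← Finset.sum_add_distrib]
    refine Finset.sum_congr rfl fun n _ => ?_
    ring
  rw [hdec]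
  refine (abs_add_le _ _).trans ((add_le_add (abs_add_le _ _) le_rfl).trans ?_)
  refine add_le_add (add_le_add ?_ le_rfl) ?_
  · -- `|c ΣΣ w β| ≤ c ΣΣ |β|`
    rw [abs_mul, abs_of_nonneg hc]
    refine mul_le_mul_of_nonneg_left ?_ hc
    refine (Finset.abs_sum_le_sum_abs _ _).trans (Finset.sum_le_sum fun i _ => ?_)
    refine (Finset.abs_sum_le_sum_abs _ _).trans (Finset.sum_le_sum fun n _ => ?_)
    rw [abs_mul]
    calc |w i n| * |β i n| ≤ 1 * |β i n| := mul_le_mul_of_nonneg_right (hw i n) (abs_nonneg _)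
      _ = |β i n| := one_mul _
  · -- `|c ΣΣ (1 − I) w (D − β)| ≤ B · c ΣΣ (1 − I)`
    rw [abs_mul, abs_of_nonneg hc, mul_left_comm, Finset.mul_sum]
    refine mul_le_mul_of_nonneg_left ?_ hc
    refine (Finset.abs_sum_le_sum_abs _ _).trans (Finset.sum_le_sum fun i hi => ?_)
    rw [Finset.mul_sum]
    refine (Finset.abs_sum_le_sum_abs _ _).trans (Finset.sum_le_sum fun n _ => ?_)
    have h1 : 0 ≤ 1 - I n := sub_nonneg.2 (hI n)
    rw [abs_mul, abs_of_nonneg h1, abs_mul, mul_comm B]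
    refine mul_le_mul_of_nonneg_left ?_ h1
    calc |w i n| * |D i n - β i n| ≤ 1 * B := mul_le_mul (hw i n) (hDβ i hi n) (abs_nonneg _) zero_le_one
      _ = B := one_mul B

/-! ## A.e. bounds and a.e.-measurability under the local Gibbs law -/

/-- **`|D| ≤ 2C` and `|β| ≤ 2C` for all `(i, n)` simultaneously, `LG`-a.e.** (`σ ≤ 1/2`, `|g| ≤ C`): `|κ| ≤ C`
holds a.e. under the invariant law, hence under `LG ≪ G`; then `|D| ≤ |g| + |κ|` and the conditional expectation
of an a.e.-bounded function is a.e. bounded. [folklore] -/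
theorem ae_forall_abs_kickDev_betaLG_le (hσ2 : σ ≤ 1 / 2) (Φ : Flow σ N) (a₀ θ₀ : T3 → ℝ) (u₀ : T3 → V3)
    (r : ℝ) {g : V3 × V3 × V3 → ℝ} {C : ℝ} (hC : ∀ p, |g p| ≤ C) :
    ∀ᵐ z ∂(localGibbsLaw σ a₀ u₀ θ₀ N Φ), ∀ i : Fin (N + 1), ∀ n : ℕ,
      |kickDev Φ r g i n z| ≤ 2 * C ∧ |betaLG σ a₀ θ₀ u₀ Φ r g i n z| ≤ 2 * C := by
  have hμν : localGibbsLaw σ a₀ u₀ θ₀ N Φ ≪ localGibbsLaw σ (fun _ => 1) (fun _ => 0) (fun _ => 1) N Φ :=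
    localGibbsLaw_absolutelyContinuous_localGibbsLaw continuous_const continuous_const
      continuous_const (fun _ => one_pos) (fun _ => one_pos) a₀ u₀ θ₀ hσ2 N Φ
  have hκ : ∀ᵐ z ∂(localGibbsLaw σ a₀ u₀ θ₀ N Φ), ∀ i : Fin (N + 1), ∀ n : ℕ, |kappa Φ r g i n z| ≤ C :=
    hμν.ae_le (ae_forall_abs_kappa_le Φ r hC)
  have hD : ∀ i : Fin (N + 1), ∀ n : ℕ, ∀ᵐ z ∂(localGibbsLaw σ a₀ u₀ θ₀ N Φ), |kickDev Φ r g i n z| ≤ 2 * C := by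
    intro i n
    filter_upwards [hκ] with z hz
    unfold kickDev
    exact (abs_sub _ _).trans (by linarith [hC (kick Φ i n z), hz i n])
  have hβ : ∀ i : Fin (N + 1), ∀ n : ℕ, ∀ᵐ z ∂(localGibbsLaw σ a₀ u₀ θ₀ N Φ),
      |betaLG σ a₀ θ₀ u₀ Φ r g i n z| ≤ 2 * C := by
    intro i n
    unfold betaLG
    exact ae_bdd_abs_condExp_of_ae_bdd_abs (hD i n)
  rw [ae_all_iff]; intro i
  rw [ae_all_iff]; intro n
  filter_upwards [hD i n, hβ i n] with z h1 h2
  exact ⟨h1, h2⟩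

/-- Under the plumbing M (landed `stub_pastMeasurable`), the `LG`-conditional bias `β` is Borel measurable. [folklore] -/
theorem measurable_betaLG (hσ : 0 < σ) (Φ : Flow σ N) (a₀ θ₀ : T3 → ℝ) (u₀ : T3 → V3) (r : ℝ)
    (g : V3 × V3 × V3 → ℝ) (i : Fin (N + 1)) (n : ℕ) : Measurable (betaLG σ a₀ θ₀ u₀ Φ r g i n) := by
  unfold betaLG
  exact (stronglyMeasurable_condExp.measurable).mono (comap_past_le stub_pastMeasurable hσ Φ r i n) le_rfl

/-- **The B1 integrand is a.e.-measurable under `LG`**: it agrees on the good set (which is `LG`-conull) with its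
version over the guarded count `gcnt`, a measurable random sum of measurable terms. [folklore] -/
theorem aemeasurable_biasFn (hσ : 0 < σ) (Φ : Flow σ N) (a₀ θ₀ : T3 → ℝ) (u₀ : T3 → V3) (τ r : ℝ)
    (g : V3 × V3 × V3 → ℝ) :
    AEMeasurable (fun z => ENNReal.ofReal (hsDiameter σ N / ((N : ℝ) + 1) *
      ∑ i : Fin (N + 1), ∑ n ∈ Finset.range (cnt Φ τ z i), |betaLG σ a₀ θ₀ u₀ Φ r g i n z|))
      (localGibbsLaw σ a₀ u₀ θ₀ N Φ) := by
  have hG : Measurable (fun z => ENNReal.ofReal (hsDiameter σ N / ((N : ℝ) + 1) *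
      ∑ i : Fin (N + 1), ∑ n ∈ Finset.range (gcnt Φ τ z i), |betaLG σ a₀ θ₀ u₀ Φ r g i n z|)) := by
    refine (Measurable.const_mul (Finset.measurable_sum _ fun i _ => ?_) _).ennreal_ofReal
    exact measurable_sum_range_of_measurable (fun n => (measurable_betaLG hσ Φ a₀ θ₀ u₀ r g i n).abs)
      (measurable_gcnt stub_pastMeasurable hσ Φ τ i)
  refine hG.aemeasurable.congr ?_
  have hgood : ∀ᵐ z ∂(localGibbsLaw σ a₀ u₀ θ₀ N Φ), z ∈ Φ.good :=
    mem_ae_iff.2 (localGibbsLaw_compl_good_eq_zero Φ)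
  filter_upwards [hgood] with z hz
  simp only [gcnt, hz, if_true]

/-- **The CT-a integrand is a.e.-measurable under `LG`** (same device). [folklore] -/
theorem aemeasurable_excessFn (hσ : 0 < σ) (Φ : Flow σ N) (a₀ θ₀ : T3 → ℝ) (u₀ : T3 → V3) (τ a : ℝ) :
    AEMeasurable (fun z => ENNReal.ofReal (hsDiameter σ N / ((N : ℝ) + 1) *
      ∑ i : Fin (N + 1), max ((cnt Φ τ z i : ℝ) - a) 0)) (localGibbsLaw σ a₀ u₀ θ₀ N Φ) := by
  have hG : Measurable (fun z => ENNReal.ofReal (hsDiameter σ N / ((N : ℝ) + 1) *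
      ∑ i : Fin (N + 1), max ((gcnt Φ τ z i : ℝ) - a) 0)) := by
    refine (Measurable.const_mul (Finset.measurable_sum _ fun i _ => ?_) _).ennreal_ofReal
    have h1 : Measurable (fun z => (gcnt Φ τ z i : ℝ)) :=
      (measurable_from_top (f := fun n : ℕ => (n : ℝ))).comp (measurable_gcnt stub_pastMeasurable hσ Φ τ i)
    exact (h1.sub_const a).max measurable_const
  refine hG.aemeasurable.congr ?_
  have hgood : ∀ᵐ z ∂(localGibbsLaw σ a₀ u₀ θ₀ N Φ), z ∈ Φ.good :=
    mem_ae_iff.2 (localGibbsLaw_compl_good_eq_zero Φ)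
  filter_upwards [hgood] with z hz
  simp only [gcnt, hz, if_true]

/-! ## The estimate at fixed `N` -/

/-- **The `L¹(LG)` splitting of the crux's kick sum** (fixed `N`, `σ ≤ 1/2`, `|g| ≤ C`, `|h| ≤ 1`, any level `a`):
`E_{LG}|S_h| ≤ E_{LG}[(ε/(N+1)) ΣΣ |β|] + E_{LG}|(ε/(N+1)) ΣΣ 1_{n<a} h (D − β)| + 4C · E_{LG}[(ε/(N+1)) Σ_i (cnt_i − a)₊]`
in the `∫⁻ … ENNReal.ofReal` currency. [folklore] -/
theorem lintegral_abs_fullSum_le (hσ : 0 < σ) (hσ2 : σ ≤ 1 / 2) (Φ : Flow σ N) (a₀ θ₀ : T3 → ℝ) (u₀ : T3 → V3)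
    (τ r : ℝ) {g : V3 × V3 × V3 → ℝ} {C : ℝ} (hC : ∀ p, |g p| ≤ C) {h : Fin (N + 1) → ℕ → Past N → ℝ}
    (hhb : ∀ i n p, |h i n p| ≤ 1) (a : ℝ) :
    ∫⁻ z, ENNReal.ofReal |fullSum Φ τ r g h z| ∂(localGibbsLaw σ a₀ u₀ θ₀ N Φ) ≤
      ∫⁻ z, ENNReal.ofReal (hsDiameter σ N / ((N : ℝ) + 1) *
          ∑ i : Fin (N + 1), ∑ n ∈ Finset.range (cnt Φ τ z i), |betaLG σ a₀ θ₀ u₀ Φ r g i n z|)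
        ∂(localGibbsLaw σ a₀ u₀ θ₀ N Φ) +
      ∫⁻ z, ENNReal.ofReal |hsDiameter σ N / ((N : ℝ) + 1) *
          ∑ i : Fin (N + 1), ∑ n ∈ Finset.range (cnt Φ τ z i),
            (if (n : ℝ) < a then (1 : ℝ) else 0) *
              (h i n (past Φ r z i n) * (kickDev Φ r g i n z - betaLG σ a₀ θ₀ u₀ Φ r g i n z))|
        ∂(localGibbsLaw σ a₀ u₀ θ₀ N Φ) +
      ENNReal.ofReal (4 * C) * ∫⁻ z, ENNReal.ofReal (hsDiameter σ N / ((N : ℝ) + 1) *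
          ∑ i : Fin (N + 1), max ((cnt Φ τ z i : ℝ) - a) 0) ∂(localGibbsLaw σ a₀ u₀ θ₀ N Φ) := by
  set μ : Measure (Phase N) := localGibbsLaw σ a₀ u₀ θ₀ N Φ with hμ
  have hC0 : 0 ≤ C := (abs_nonneg _).trans (hC 0)
  have hc0 : 0 ≤ hsDiameter σ N / ((N : ℝ) + 1) := div_nonneg (hsDiameter_pos hσ N).le (by positivity)
  -- the three pieces, as real functions
  set P1 : Phase N → ℝ := fun z => hsDiameter σ N / ((N : ℝ) + 1) *
    ∑ i : Fin (N + 1), ∑ n ∈ Finset.range (cnt Φ τ z i), |betaLG σ a₀ θ₀ u₀ Φ r g i n z| with hP1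
  set P2 : Phase N → ℝ := fun z => hsDiameter σ N / ((N : ℝ) + 1) *
    ∑ i : Fin (N + 1), ∑ n ∈ Finset.range (cnt Φ τ z i),
      (if (n : ℝ) < a then (1 : ℝ) else 0) *
        (h i n (past Φ r z i n) * (kickDev Φ r g i n z - betaLG σ a₀ θ₀ u₀ Φ r g i n z)) with hP2
  set P3 : Phase N → ℝ := fun z => hsDiameter σ N / ((N : ℝ) + 1) *
    ∑ i : Fin (N + 1), max ((cnt Φ τ z i : ℝ) - a) 0 with hP3
  have hP1nn : ∀ z, 0 ≤ P1 z := fun z =>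
    mul_nonneg hc0 (Finset.sum_nonneg fun i _ => Finset.sum_nonneg fun n _ => abs_nonneg _)
  have hP3nn : ∀ z, 0 ≤ P3 z := fun z =>
    mul_nonneg hc0 (Finset.sum_nonneg fun i _ => le_max_right _ _)
  -- the pointwise splitting, a.e.
  have hpt : ∀ᵐ z ∂μ, ENNReal.ofReal |fullSum Φ τ r g h z| ≤
      ENNReal.ofReal (P1 z) + ENNReal.ofReal |P2 z| + ENNReal.ofReal (4 * C) * ENNReal.ofReal (P3 z) := by
    filter_upwards [ae_forall_abs_kickDev_betaLG_le hσ2 Φ a₀ θ₀ u₀ r hC] with z hz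
    have hDβ : ∀ i ∈ (Finset.univ : Finset (Fin (N + 1))), ∀ n : ℕ,
        |kickDev Φ r g i n z - betaLG σ a₀ θ₀ u₀ Φ r g i n z| ≤ 4 * C := by
      intro i _ n
      exact (abs_sub _ _).trans (by linarith [(hz i n).1, (hz i n).2])
    have key := abs_mul_sum_sum_le Finset.univ (cnt Φ τ z) (fun i n => h i n (past Φ r z i n))
      (fun i n => kickDev Φ r g i n z) (fun i n => betaLG σ a₀ θ₀ u₀ Φ r g i n z)
      (fun n => if (n : ℝ) < a then (1 : ℝ) else 0) hc0 (fun i n => hhb i n _)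
      (fun n => by split_ifs <;> norm_num) hDβ
    have htail : 4 * C * (hsDiameter σ N / ((N : ℝ) + 1) * ∑ i : Fin (N + 1),
        ∑ n ∈ Finset.range (cnt Φ τ z i), (1 - (if (n : ℝ) < a then (1 : ℝ) else 0))) ≤ 4 * C * P3 z :=
      mul_le_mul_of_nonneg_left (mul_le_mul_of_nonneg_left
        (Finset.sum_le_sum fun i _ => sum_range_one_sub_ite_le _ _) hc0) (by positivity)
    rw [← ENNReal.ofReal_mul (by positivity), ← ENNReal.ofReal_add (hP1nn z) (abs_nonneg _),
      ← ENNReal.ofReal_add (add_nonneg (hP1nn z) (abs_nonneg _)) (mul_nonneg (by positivity) (hP3nn z))]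
    refine ENNReal.ofReal_le_ofReal ?_
    exact key.trans (add_le_add le_rfl htail)
  -- a.e.-measurability of two of the three pieces
  have hP1ae : AEMeasurable (fun z => ENNReal.ofReal (P1 z)) μ := aemeasurable_biasFn hσ Φ a₀ θ₀ u₀ τ r g
  have hP3ae : AEMeasurable (fun z => ENNReal.ofReal (4 * C) * ENNReal.ofReal (P3 z)) μ :=
    (aemeasurable_excessFn hσ Φ a₀ θ₀ u₀ τ a).const_mul _
  -- integrate
  calc ∫⁻ z, ENNReal.ofReal |fullSum Φ τ r g h z| ∂μ
      ≤ ∫⁻ z, ENNReal.ofReal (P1 z) + ENNReal.ofReal |P2 z| + ENNReal.ofReal (4 * C) * ENNReal.ofReal (P3 z) ∂μ :=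
        lintegral_mono_ae hpt
    _ = ∫⁻ z, ENNReal.ofReal (P1 z) + ENNReal.ofReal |P2 z| ∂μ +
          ∫⁻ z, ENNReal.ofReal (4 * C) * ENNReal.ofReal (P3 z) ∂μ := lintegral_add_right' _ hP3ae
    _ = ∫⁻ z, ENNReal.ofReal (P1 z) ∂μ + ∫⁻ z, ENNReal.ofReal |P2 z| ∂μ +
          ENNReal.ofReal (4 * C) * ∫⁻ z, ENNReal.ofReal (P3 z) ∂μ := by
        rw [lintegral_add_left' hP1ae, lintegral_const_mul' _ _ ENNReal.ofReal_ne_top]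

/-! ## The stub -/

/-- **STUB Red-A `stub_reductionA` — first half of the reduction of the line `condition-the-past`.**
`B1 → CT-a → TF → MesoBody rs`: given `Φ, τ, g (|g| ≤ C), δ` and admissible `h`, `LG`-a.e.
`|S_h| ≤ (ε/(N+1))ΣΣ|β| + |TF-sum| + 4C·(ε/(N+1))Σ_i (cnt_i − A(N+1)^{1/3})₊`; integrate
(`lintegral_abs_fullSum_le`), with `σ₀ := min` of the three thresholds and `1/2`, `N₀ := max`, B1 at `δ/3`,
CT-a at `δ/(3(4C+1))` (giving `A`), TF at `(A, δ/3)`; `KickBoundRel … = ∫⁻ ofReal |fullSum …|` definitionally. [folklore] -/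
theorem stub_reductionA : SingleKickBias rs → CountExcessLG → TruncatedFluctuation rs → MesoBody rs := by
  intro hB1 hCT hTF a₀ θ₀ u₀ ha hθ hu ha0 hθ0
  obtain ⟨σ₁, hσ₁, H1⟩ := hB1 a₀ θ₀ u₀ ha hθ hu ha0 hθ0
  obtain ⟨σ₂, hσ₂, H2⟩ := hCT a₀ θ₀ u₀ ha hθ hu ha0 hθ0
  obtain ⟨σ₃, hσ₃, H3⟩ := hTF a₀ θ₀ u₀ ha hθ hu ha0 hθ0
  refine ⟨min (min σ₁ σ₂) (min σ₃ (1 / 2)), lt_min (lt_min hσ₁ hσ₂) (lt_min hσ₃ (by norm_num)), ?_⟩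
  intro σ hσ hσlt Φ τ hτ g hg hgb δ hδ
  have hσ1 : σ < σ₁ := hσlt.trans_le ((min_le_left _ _).trans (min_le_left _ _))
  have hσ2' : σ < σ₂ := hσlt.trans_le ((min_le_left _ _).trans (min_le_right _ _))
  have hσ3 : σ < σ₃ := hσlt.trans_le ((min_le_right _ _).trans (min_le_left _ _))
  have hσ12 : σ ≤ 1 / 2 := (hσlt.trans_le ((min_le_right _ _).trans (min_le_right _ _))).le
  obtain ⟨C, hC⟩ := hgb
  have hC0 : 0 ≤ C := (abs_nonneg _).trans (hC 0)
  have h4C1 : 0 < 4 * C + 1 := by positivity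
  obtain ⟨N₁, hN₁⟩ := H1 σ hσ hσ1 Φ τ hτ g hg ⟨C, hC⟩ (δ / 3) (by positivity)
  obtain ⟨A, hA, N₂, hN₂⟩ := H2 σ hσ hσ2' Φ τ hτ (δ / (3 * (4 * C + 1))) (by positivity)
  obtain ⟨N₃, hN₃⟩ := H3 σ hσ hσ3 Φ τ hτ g hg ⟨C, hC⟩ A hA (δ / 3) (by positivity)
  refine ⟨max N₁ (max N₂ N₃), fun N hN h hhm hhb => ?_⟩
  have hN1 : N₁ ≤ N := (le_max_left _ _).trans hN
  have hN2 : N₂ ≤ N := ((le_max_left _ _).trans (le_max_right _ _)).trans hN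
  have hN3 : N₃ ≤ N := ((le_max_right _ _).trans (le_max_right _ _)).trans hN
  -- the goal is the crux's let-chain; it is the local Gibbs mean of `fullSum`
  change ∫⁻ z, ENNReal.ofReal |fullSum (Φ N) τ (rs N) g h z| ∂(localGibbsLaw σ a₀ u₀ θ₀ N (Φ N)) ≤
    ENNReal.ofReal δ
  have h1 := hN₁ N hN1
  have h2 := hN₃ N hN3 h hhm hhb
  have h3 := hN₂ N hN2
  have key : 4 * C * (δ / (3 * (4 * C + 1))) ≤ δ / 3 := by
    have hq : 4 * C / (4 * C + 1) ≤ 1 := (div_le_one h4C1).2 (by linarith)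
    calc 4 * C * (δ / (3 * (4 * C + 1))) = δ / 3 * (4 * C / (4 * C + 1)) := by
          field_simp
      _ ≤ δ / 3 * 1 := mul_le_mul_of_nonneg_left hq (by positivity)
      _ = δ / 3 := mul_one _
  calc ∫⁻ z, ENNReal.ofReal |fullSum (Φ N) τ (rs N) g h z| ∂(localGibbsLaw σ a₀ u₀ θ₀ N (Φ N))
      ≤ _ := lintegral_abs_fullSum_le hσ hσ12 (Φ N) a₀ θ₀ u₀ τ (rs N) hC hhb (A * ((N : ℝ) + 1) ^ (1 / 3 : ℝ))
    _ ≤ ENNReal.ofReal (δ / 3) + ENNReal.ofReal (δ / 3) +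
          ENNReal.ofReal (4 * C) * ENNReal.ofReal (δ / (3 * (4 * C + 1))) :=
        add_le_add (add_le_add h1 h2) (mul_le_mul_right h3 _)
    _ = ENNReal.ofReal (δ / 3 + δ / 3 + 4 * C * (δ / (3 * (4 * C + 1)))) := by
        rw [← ENNReal.ofReal_mul (by positivity), ← ENNReal.ofReal_add (by positivity) (by positivity),
          ← ENNReal.ofReal_add (by positivity) (by positivity)]
    _ ≤ ENNReal.ofReal δ := ENNReal.ofReal_le_ofReal (by linarith)

end Summit.AtomisticToContinuum.HydrodynamicLimit.Theorems.KickFairRelEquilibriumMesoLine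

end
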